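import Summits.ResolutionOfSingularities.ResolutionOfSingularities.Theorems.PurelyInseparableDim4ChartTransfer
import HarnessLib

/-!
# Purely inseparable four-folds `z^p + F(x₁, …, x₄)`: the chart dictionary for coordinate centres,
# SCHEME LEVEL II (brick TY-2 (c) of cell `res-dim4-pi`: re-centring and cleaning — the blow-up step
# IS `CentreBlowup.step`)

[OURS · counted 0] (D-0157 DOOR 2; director-resolution DR-157-C; desk `boards/WAVE2.md` row TY-2
«chart dictionary for coordinate centres = S3 (a)», named deliverable `strictTransform_chart_eq_step`).
Sequel of `PurelyInseparableDim4ChartDictionary.lean` (ring level) and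
`PurelyInseparableDim4ChartTransfer.lean` (chart transfer). Setting as there: `K` a PERFECT field of
characteristic `p` (e.g. algebraically closed), `P = 𝔸⁵_K = Spec K[z, x₁, …, x₄]`
(`AffinePointBlowup.P 4 K`), a presented state `s` of the cell (`PIDim4.State`), a coordinate centre
`S ∋ j` with `p ≤ ord_{(x_S)} s.F` (Hironaka-permissible, `PIDim4.IsPermissibleCentre`), a point `b`
of the exceptional hyperplane of the `x_j`-chart (`b_j = 0`), and ANY blowing up `π : W → P` of
`AffineCoordBlowup.𝓘Λ 4 K Λ_S` (`IsBlowup`). PROVED here (no `sorry`, no new axiom):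

* **`controlledTransform_chart_eq_step`** — there is a `K`-algebra automorphism `Θ` of `K[z, x]`,
  the translation `x ↦ x + b` followed by a cleaning `z ↦ z + h(x)` (both recorded by their values on
  the variables), such that the controlled transform `σᶜ((z^p + s.F)·𝒪, p)` (BGMW §3.2, the tree's
  `controlledTransform`) pulled back along `Spec Θ ≫ chartImm : 𝔸⁵_K → W` is the ideal sheaf
  `PIDim4.hypSheaf p (CentreBlowup.step p S j b s).F` of the tree's NEXT STATE;
* **`strictTransform_chart_eq_step`** — the same for the strict transform
  `⋃ₙ (π^*(z^p + s.F)·𝒪 : 𝓘(D)ⁿ)` (the tree's `strictTransformIdeal`; strict = controlled with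
  `m = p` for this hypersurface);
* `transform_ideal_chart_eq_step` — the marked-ideal form: the ideal of
  `MarkedIdeal.transform π 𝓘Λ (𝔸⁵, (z^p + s.F)·𝒪, E, p)` read on the re-centred cleaned chart;
* `controlledTransform_chart_eq_of_edge` — the same along an edge `s ⟶ s'` of the cell's relation
  `PIDim4.Edge p S` (every MODE-0/1h/2/HP step of the Target file is such an edge).

This is the scheme-level meaning of ONE step of the cell's coordinate-centre walk: LOCALLY (on the
standard chart containing the point, after a `K`-automorphism of the chart) the transform of the
hypersurface is the hypersurface of the next presented state. What is NOT here: which closed points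
of `W` are the `p`-fold points (brick TY-3, `PurelyInseparableDim4Equimultiple.lean`), the boundary /
snc bookkeeping of `MarkedIdeal.transform`, and the globalisation of the local branches (frame
`PIDim4.TerminationImpliesOrderReduction`); resolution of singularities in dimension ≥ 4 /
characteristic `p` is NOT proved anywhere in this programme. bears_on: LADDER-RESOLUTION:D157-DOOR2
(res-dim4-pi). Supports stmt-ResolutionOfSingularities-16155 (helper, TY-2 (c)).
-/

-- every declaration of this summit lives under `Summit.ResolutionOfSingularities.ResolutionOfSingularities`
-- (summit = problem), which the duplicate-namespace linter flags; house convention (cf. the Target file).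
set_option linter.dupNamespace false

noncomputable section

open MvPolynomial Finset CategoryTheory AlgebraicGeometry Opposite
open AlgebraicGeometry.Scheme.IdealSheafData (ofIdealTop)

namespace Summit.ResolutionOfSingularities.ResolutionOfSingularities.Theorems.PIDim4

open Literature.AlgebraicGeometry.Resolution
open Literature.AlgebraicGeometry.Resolution.Hauser2010
open Literature.AlgebraicGeometry.Resolution.AffinePointBlowup (P A γ coord Wtop)

namespace ChartDictionary

section Step

variable {K : Type} [Field K] {S : Finset (Fin 4)} {j : Fin 4} {W : Scheme.{0}} {π : W ⟶ P 4 K}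

/-! ## §4 Re-centring at the point `b` and cleaning: the transform is `V(z^p + step.F)` -/

/-- The ideal sheaf of `z^q + G`, pulled back along `Spec Θ` for a ring endomorphism `Θ` of `K[z, x]`,
is the ideal sheaf of `Θ(z^q + G)`. -/
theorem comap_hypSheaf_specMap (q : ℕ) (Θ : A 4 K →+* A 4 K) (G : MvPolynomial (Fin 4) K) :
    (hypSheaf q G).comap (Spec.map (CommRingCat.ofHom Θ)) =
      ofIdealTop (Ideal.span {(γ 4 K).symm (Θ (hyp q G))}) :=
  comap_ofIdealTop_span_γ_symm Θ (hyp q G)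

/-- **THE CHART DICTIONARY, controlled transform** (class of record `e = 1`). Let `K` be a perfect
field of characteristic `p`, `s` a presented state, `S ∋ j` with `p ≤ ord_{(x_S)} s.F` (permissible),
`b` a point of the exceptional hyperplane of the `x_j`-chart (`b_j = 0`), and `π : W → 𝔸⁵_K` ANY
blowing up along `V(z, x_S)`. Then there is a `K`-automorphism `Θ` of `K[z, x]` — the translation
`x ↦ x + b` followed by a cleaning `z ↦ z + h(x)` — such that the controlled transform
`σᶜ((z^p + s.F)·𝒪, p)`, pulled back along `Spec Θ ≫ chartImm : 𝔸⁵_K → W`, is the ideal sheaf of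
`z^p + (CentreBlowup.step p S j b s).F`: the tree's combinatorial step IS the blow-up step read in the
re-centred, cleaned `x_j`-chart. -/
theorem controlledTransform_chart_eq_step (p : ℕ) [Fact p.Prime] [CharP K p] [PerfectRing K p]
    [DecidableEq K] (hj : j ∈ S) {b : Fin 4 → K} (hbj : b j = 0) (s : State K)
    (hperm : (p : ℕ∞) ≤ CentreBlowup.ordAlong S s.F)
    (hπ : IsBlowup π (AffineCoordBlowup.𝓘Λ 4 K (insert 0 (Fin.succ '' (S : Set (Fin 4)))))) :
    ∃ (Θ : A 4 K ≃ₐ[K] A 4 K) (h : MvPolynomial (Fin 4) K),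
      Θ (X 0) = X 0 + rename Fin.succ h ∧ (∀ i : Fin 4, Θ (X i.succ) = X i.succ + C (b i)) ∧
      (controlledTransform π (AffineCoordBlowup.𝓘Λ 4 K (insert 0 (Fin.succ '' (S : Set (Fin 4)))))
          (hypSheaf p s.F) p).comap
        (Spec.map (CommRingCat.ofHom (Θ : A 4 K →+* A 4 K)) ≫
          AffineCoordBlowup.chartImm hπ (succ_mem_centreVars hj)) =
      hypSheaf p (CentreBlowup.step p S j b s).F := by
  obtain ⟨θ, h, h0, hs, -, h2⟩ := exists_clean_translate_hyp_eq_step p hj hbj s hperm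
  refine ⟨(AffinePointBlowup.translateEquiv (Fin.cases 0 b)).trans θ, h, ?_, fun i => ?_, ?_⟩
  · rw [AlgEquiv.trans_apply, AffinePointBlowup.translateEquiv_X, Fin.cases_zero, C_0, add_zero, h0]
  · rw [AlgEquiv.trans_apply, AffinePointBlowup.translateEquiv_X, Fin.cases_succ, map_add, hs]
    exact congrArg _ (θ.commutes (b i))
  · rw [Scheme.IdealSheafData.comap_comp, controlledTransform_comap_chartImm p hj s.F hperm hπ,
      comap_hypSheaf_specMap, hypSheaf]
    congr 3
    rw [← h2]
    rfl

/-- **THE CHART DICTIONARY, strict transform** (the desk's `strictTransform_chart_eq_step`): same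
statement for the strict transform `⋃ₙ (π^*(z^p + s.F)·𝒪 : 𝓘(D)ⁿ)` of the hypersurface — on the
re-centred, cleaned `x_j`-chart it is `V(z^p + (CentreBlowup.step p S j b s).F)`. -/
theorem strictTransform_chart_eq_step (p : ℕ) [Fact p.Prime] [CharP K p] [PerfectRing K p]
    [DecidableEq K] (hj : j ∈ S) {b : Fin 4 → K} (hbj : b j = 0) (s : State K)
    (hperm : (p : ℕ∞) ≤ CentreBlowup.ordAlong S s.F)
    (hπ : IsBlowup π (AffineCoordBlowup.𝓘Λ 4 K (insert 0 (Fin.succ '' (S : Set (Fin 4)))))) :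
    ∃ (Θ : A 4 K ≃ₐ[K] A 4 K) (h : MvPolynomial (Fin 4) K),
      Θ (X 0) = X 0 + rename Fin.succ h ∧ (∀ i : Fin 4, Θ (X i.succ) = X i.succ + C (b i)) ∧
      (strictTransformIdeal π (AffineCoordBlowup.𝓘Λ 4 K (insert 0 (Fin.succ '' (S : Set (Fin 4)))))
          (hypSheaf p s.F)).comap
        (Spec.map (CommRingCat.ofHom (Θ : A 4 K →+* A 4 K)) ≫
          AffineCoordBlowup.chartImm hπ (succ_mem_centreVars hj)) =
      hypSheaf p (CentreBlowup.step p S j b s).F := by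
  obtain ⟨θ, h, h0, hs, -, h2⟩ := exists_clean_translate_hyp_eq_step p hj hbj s hperm
  refine ⟨(AffinePointBlowup.translateEquiv (Fin.cases 0 b)).trans θ, h, ?_, fun i => ?_, ?_⟩
  · rw [AlgEquiv.trans_apply, AffinePointBlowup.translateEquiv_X, Fin.cases_zero, C_0, add_zero, h0]
  · rw [AlgEquiv.trans_apply, AffinePointBlowup.translateEquiv_X, Fin.cases_succ, map_add, hs]
    exact congrArg _ (θ.commutes (b i))
  · rw [Scheme.IdealSheafData.comap_comp,
      strictTransformIdeal_comap_chartImm (Nat.Prime.ne_zero Fact.out) hj s.F hperm hπ,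
      comap_hypSheaf_specMap, hypSheaf]
    congr 3
    rw [← h2]
    rfl

/-- **THE CHART DICTIONARY, marked-ideal form.** For the marked ideal `(𝔸⁵_K, (z^p + s.F)·𝒪, E, p)`
(any boundary list `E`) and ANY blowing up `π` along `V(z, x_S)`, the ideal of the transformed marked
ideal (`MarkedIdeal.transform`, BGMW Def. 3.1.3 (3): the controlled transform, same marking `p`),
read on the re-centred cleaned `x_j`-chart, is `(z^p + (CentreBlowup.step p S j b s).F)·𝒪`. -/
theorem transform_ideal_chart_eq_step (p : ℕ) [Fact p.Prime] [CharP K p] [PerfectRing K p]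
    [DecidableEq K] (hj : j ∈ S) {b : Fin 4 → K} (hbj : b j = 0) (s : State K)
    (hperm : (p : ℕ∞) ≤ CentreBlowup.ordAlong S s.F) (E : List (P 4 K).IdealSheafData)
    (hπ : IsBlowup π (AffineCoordBlowup.𝓘Λ 4 K (insert 0 (Fin.succ '' (S : Set (Fin 4)))))) :
    ∃ (Θ : A 4 K ≃ₐ[K] A 4 K) (h : MvPolynomial (Fin 4) K),
      Θ (X 0) = X 0 + rename Fin.succ h ∧ (∀ i : Fin 4, Θ (X i.succ) = X i.succ + C (b i)) ∧
      (((⟨hypSheaf p s.F, E, p⟩ : MarkedIdeal (P 4 K)).transform π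
          (AffineCoordBlowup.𝓘Λ 4 K (insert 0 (Fin.succ '' (S : Set (Fin 4)))))).ideal).comap
        (Spec.map (CommRingCat.ofHom (Θ : A 4 K →+* A 4 K)) ≫
          AffineCoordBlowup.chartImm hπ (succ_mem_centreVars hj)) =
      hypSheaf p (CentreBlowup.step p S j b s).F := by
  rw [MarkedIdeal.transform_ideal]
  exact controlledTransform_chart_eq_step p hj hbj s hperm hπ

/-- **One edge of the cell's walk, scheme level.** For an edge `s ⟶ s'` of `PIDim4.Edge p S`
along a Hironaka-permissible coordinate centre `S` (any of the Target file's step relations) and ANY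
blowing up `π` of `𝔸⁵_K` along `V(z, x_S)`: on some standard chart `x_j` (`j ∈ S`), after a
`K`-automorphism `Θ` of the chart moving the visited point to the origin and cleaning, the controlled
transform of `(z^p + s.F)·𝒪` with marking `p` is `(z^p + s'.F)·𝒪`. -/
theorem controlledTransform_chart_eq_of_edge (p : ℕ) [Fact p.Prime] [CharP K p] [PerfectRing K p]
    [DecidableEq K] {s s' : State K} (hS : IsPermissibleCentre p S s.F) (he : Edge p S s s')
    (hπ : IsBlowup π (AffineCoordBlowup.𝓘Λ 4 K (insert 0 (Fin.succ '' (S : Set (Fin 4)))))) :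
    ∃ (j : Fin 4) (hj : j ∈ S) (b : Fin 4 → K) (Θ : A 4 K ≃ₐ[K] A 4 K) (h : MvPolynomial (Fin 4) K),
      b j = 0 ∧ Θ (X 0) = X 0 + rename Fin.succ h ∧ (∀ i : Fin 4, Θ (X i.succ) = X i.succ + C (b i)) ∧
      (controlledTransform π (AffineCoordBlowup.𝓘Λ 4 K (insert 0 (Fin.succ '' (S : Set (Fin 4)))))
          (hypSheaf p s.F) p).comap
        (Spec.map (CommRingCat.ofHom (Θ : A 4 K →+* A 4 K)) ≫
          AffineCoordBlowup.chartImm hπ (succ_mem_centreVars hj)) =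
      hypSheaf p s'.F := by
  obtain ⟨j, b, hj, hbj, -, -, rfl⟩ := he
  obtain ⟨Θ, h, h0, hs, hc⟩ := controlledTransform_chart_eq_step p hj hbj s hS.2 hπ
  exact ⟨j, hj, b, Θ, h, hbj, h0, hs, hc⟩

end Step

end ChartDictionary

end Summit.ResolutionOfSingularities.ResolutionOfSingularities.Theorems.PIDim4

end
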